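import Summits.CriticalPhenomena.PercolationContinuityZ3.Theorems.PercNearOneGluingAdditiveGluingSetObserverPeel
import Summits.CriticalPhenomena.PercolationContinuityZ3.Theorems.PercNearOneGluingAdditiveGluingTFingers
import Summits.CriticalPhenomena.PercolationContinuityZ3.Theorems.PercNearOneGluingAdditiveGluingFingerSetForm
import HarnessLib

/-!
# Conjecture G / SET-W via a SET observer, II: SET-W and the finger multi-edge Lemma 3 (`stub_fingerML3_vp`) from the
# set two-observer margin — seat (b) V⁺-form `png-dp-vplus`, gen 12

Support file (`--supports stmt-CriticalPhenomena-4576`); no definitions, no named facts, no sorries.  Sequel of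
`…AdditiveGluingSetObserverPeel.lean` (memo MEMO-gen12.md of run/shared/lean/prim/prim-png-dp-vplus/).

* `setW_of_twoObs` — **SET-W** (`μ(d↔b, O≁d, O~A) ≤ μ(O~b, O≁d)` for `d ∈ A` of least `μ(·↔b)`, any observer set `O`;
  = Kozma–Nitzan's display (3) at the contracted vertex `[O]` of `Γ/O` with the witness designated in `Γ`), from the set
  pre-FKG surplus inequality for `F = 1{b ∈ ·}` (`setPreSurplus_nonneg_of_twoObs`): the first-touched patterns `P^O_a`, `a ≠ d`,
  cover `{d↔b}∩{O≁d}∩{O~A}` and their pieces `P^O_a ∩ {a↔b}` are disjoint subsets of `{O~b}∩{O≁d}`.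
* `fingerML3_of_twoObs` — the registered V⁺ stub `stub_fingerML3_vp` (conjecture G: every `|A|`, any block) follows, via the
  unglued set form (`fingerML3_of_setForm`) and the null contact event (`finger_noContact_reach_null`).
Both are CONDITIONAL on the set two-observer margin `h2obs` (set-observer analogue of `PreFKGSurplus.preMargin_nonneg_of_csh` at
`D = []`; numerically 0 violations, memo §2); discharging `h2obs` = porting the conditioned slack hierarchy to a set observer.
[cite: KozmaNitzan2024, display (3) (p. 3), Thm 4 (pp. 12–14), Conj. 4 (p. 32)] [cite: VandenbergHaggstromKahn2005, Thm. 2.1 (p. 9)]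
-/

noncomputable section

namespace Summit.CriticalPhenomena.PercolationContinuityZ3.Theorems

open MeasureTheory Set Literature.Probability.LatticeModels Literature.Probability.Percolation
open scoped Classical
open KNPreFKG

/-! ### SET-W and conjecture G (`stub_fingerML3_vp`) from the set two-observer margin -/

namespace SetSurplus

variable {n : ℕ}

/-- The mean of the indicator functional `1{b ∈ ·}` at `a` is `μ(a ↔ b)`. [folklore] -/
theorem integral_indicator_mem_openCluster (w : Sym2 (Fin n) → unitInterval) (a b : Fin n) :
    ∫ ω, (fun S : Set (Fin n) => if b ∈ S then (1 : ℝ) else 0) (openCluster ω a) ∂(prodBernoulli w) =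
      (prodBernoulli w).real (openConn a b) := by
  have h : (fun ω : BondConfig (Fin n) => (fun S : Set (Fin n) => if b ∈ S then (1 : ℝ) else 0) (openCluster ω a)) =
      (openConn a b : Set (BondConfig (Fin n))).indicator 1 := by
    funext ω
    by_cases hω : ω ∈ (openConn a b : Set (BondConfig (Fin n)))
    · rw [indicator_of_mem hω, Pi.one_apply]; exact if_pos (show b ∈ openCluster ω a from hω)
    · rw [indicator_of_notMem hω]; exact if_neg (show b ∉ openCluster ω a from hω)
  rw [h, integral_indicator_one MeasurableSet.of_discrete]

/-- **SET-W from the set two-observer margin.**  For a relay set `A ∋ b`, a designated relay `d ∈ A` with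
`μ(d ↔ b) ≤ μ(a ↔ b)` for all `a ∈ A`, and any observer set `O`:
`μ(d↔b ∩ {O ≁ d} ∩ {O ~ A}) ≤ μ({O ~ b} ∩ {O ≁ d})` — Kozma–Nitzan's display (3) at the contracted observer `[O]` of `Γ/O`
with the witness designated in `Γ` — PROVIDED the set two-observer margin `h2obs` holds for the functional `1{b ∈ ·}`.
[cite: KozmaNitzan2024, display (3) (p. 3), Conj. 4 (p. 32), Thm 4 (pp. 12–14)] -/
theorem setW_of_twoObs (w : Sym2 (Fin n) → unitInterval) (A O : Finset (Fin n)) (d b : Fin n) (hdA : d ∈ A)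
    (hmin : ∀ a ∈ A, (prodBernoulli w).real (openConn d b) ≤ (prodBernoulli w).real (openConn a b))
    (h2obs : ∀ (r : Fin n → ℕ) (X' : Finset (Fin n)) (k : Fin n), d ∈ X' → k ∉ X' →
      (∀ a ∈ X', ∫ ω, (fun S : Set (Fin n) => if b ∈ S then (1 : ℝ) else 0) (openCluster ω d) ∂(prodBernoulli w) ≤
        ∫ ω, (fun S : Set (Fin n) => if b ∈ S then (1 : ℝ) else 0) (openCluster ω a) ∂(prodBernoulli w)) →
      (∀ a ∈ X', a ≠ d → r d < r a) → Set.InjOn r ↑X' →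
      (prodBernoulli w).real ({ω : BondConfig (Fin n) | ∃ o ∈ O, (openGraph ω).Reachable o k} ∩
          {ω | ∀ o ∈ O, ∀ a ∈ X', ¬ (openGraph ω).Reachable o a}) *
        (∫ ω in ⋃ a ∈ X', openConn k a, ((fun S : Set (Fin n) => if b ∈ S then (1 : ℝ) else 0) (openCluster ω k) -
          (fun S : Set (Fin n) => if b ∈ S then (1 : ℝ) else 0) (openCluster ω d)) ∂(prodBernoulli w)) ≤
      (prodBernoulli w).real {ω : BondConfig (Fin n) | ∀ a ∈ (↑X' : Set (Fin n)), ¬ (openGraph ω).Reachable k a} *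
        ∑ a ∈ X', ∫ ω in {ω : BondConfig (Fin n) | ∃ o ∈ O, (openGraph ω).Reachable o a} ∩
          {ω | ∀ a' ∈ X', r a' < r a → ∀ o ∈ O, ¬ (openGraph ω).Reachable o a'},
          ((fun S : Set (Fin n) => if b ∈ S then (1 : ℝ) else 0) (openCluster ω a) -
            (fun S : Set (Fin n) => if b ∈ S then (1 : ℝ) else 0) (openCluster ω d)) ∂(prodBernoulli w)) :
    (prodBernoulli w).real (openConn d b ∩ {ω : BondConfig (Fin n) | ∀ o ∈ O, ¬ (openGraph ω).Reachable o d} ∩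
        {ω | ∃ o ∈ O, ∃ a ∈ A, (openGraph ω).Reachable o a}) ≤
      (prodBernoulli w).real ({ω : BondConfig (Fin n) | ∃ o ∈ O, (openGraph ω).Reachable o b} ∩
        {ω | ∀ o ∈ O, ¬ (openGraph ω).Reachable o d}) := by
  set μ := prodBernoulli w with hμ
  have hmeas : ∀ S : Set (BondConfig (Fin n)), MeasurableSet S := fun _ => MeasurableSet.of_discrete
  have hint : ∀ (g : BondConfig (Fin n) → ℝ), Integrable g μ := fun g => Integrable.of_finite
  set F : Set (Fin n) → ℝ := fun S => if b ∈ S then (1 : ℝ) else 0 with hFdef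
  have hF : ∀ S T : Set (Fin n), S ⊆ T → F S ≤ F T := by
    intro S T hST; simp only [hFdef]
    by_cases hS : b ∈ S
    · rw [if_pos hS, if_pos (hST hS)]
    · rw [if_neg hS]; split_ifs <;> norm_num
  -- rank: `d` first, then the vertex index
  set r : Fin n → ℕ := fun a => if a = d then 0 else (a : ℕ) + 1 with hr
  have hrd : ∀ a ∈ A, a ≠ d → r d < r a := by intro a _ had; simp [hr, had]
  have hrinj : Set.InjOn r ↑A := by
    intro a _ a' _ h
    simp only [hr] at h
    by_cases ha : a = d <;> by_cases ha' : a' = d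
    · rw [ha, ha']
    · rw [if_pos ha, if_neg ha'] at h; omega
    · rw [if_neg ha, if_pos ha'] at h; omega
    · rw [if_neg ha, if_neg ha'] at h; exact Fin.ext (by omega)
  have hcmin : ∀ a ∈ A, ∫ ω, F (openCluster ω d) ∂μ ≤ ∫ ω, F (openCluster ω a) ∂μ := by
    intro a ha
    rw [integral_indicator_mem_openCluster, integral_indicator_mem_openCluster]
    exact hmin a ha
  have hpos := setPreSurplus_nonneg_of_twoObs w O F hF d r (fun X' k hd hk hm hrk hinj => h2obs r X' k hd hk hm hrk hinj)
    A hdA hcmin hrd hrinj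
  -- the pattern events and their values for `F = 1{b ∈ ·}`
  set P : Fin n → Set (BondConfig (Fin n)) := fun a => {ω : BondConfig (Fin n) | ∃ o ∈ O, (openGraph ω).Reachable o a} ∩
    {ω | ∀ a' ∈ A, r a' < r a → ∀ o ∈ O, ¬ (openGraph ω).Reachable o a'} with hP
  have hterm : ∀ a ∈ A, ∫ ω in P a, (F (openCluster ω a) - F (openCluster ω d)) ∂μ =
      μ.real (P a ∩ openConn a b) - μ.real (P a ∩ openConn d b) := by
    intro a _
    rw [integral_sub (hint _).integrableOn (hint _).integrableOn]
    have e1 : ∀ u : Fin n, ∫ ω in P a, F (openCluster ω u) ∂μ = μ.real (P a ∩ openConn u b) := by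
      intro u
      have : (fun ω : BondConfig (Fin n) => F (openCluster ω u)) = (openConn u b : Set (BondConfig (Fin n))).indicator 1 := by
        funext ω
        by_cases hω : ω ∈ (openConn u b : Set (BondConfig (Fin n)))
        · rw [indicator_of_mem hω, Pi.one_apply]; exact if_pos (show b ∈ openCluster ω u from hω)
        · rw [indicator_of_notMem hω]; exact if_neg (show b ∉ openCluster ω u from hω)
      rw [this, setIntegral_indicator_one_eq]
    rw [e1 a, e1 d]
  have hsum : ∑ a ∈ A, ∫ ω in P a, (F (openCluster ω a) - F (openCluster ω d)) ∂μ =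
      ∑ a ∈ A.erase d, (μ.real (P a ∩ openConn a b) - μ.real (P a ∩ openConn d b)) := by
    rw [← Finset.add_sum_erase A _ hdA, hterm d hdA, sub_self, zero_add]
    exact Finset.sum_congr rfl fun a ha => hterm a (Finset.mem_of_mem_erase ha)
  have hpos' : ∑ a ∈ A.erase d, μ.real (P a ∩ openConn d b) ≤ ∑ a ∈ A.erase d, μ.real (P a ∩ openConn a b) := by
    have := hpos; rw [hsum, Finset.sum_sub_distrib] at this; linarith
  -- lower bound: the left-hand side of SET-W is covered by the patterns `P a`, `a ≠ d`
  have hcover : (openConn d b ∩ {ω : BondConfig (Fin n) | ∀ o ∈ O, ¬ (openGraph ω).Reachable o d} ∩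
      {ω | ∃ o ∈ O, ∃ a ∈ A, (openGraph ω).Reachable o a}) ⊆ ⋃ a ∈ A.erase d, (P a ∩ openConn d b) := by
    rintro ω ⟨⟨hdb, hOd⟩, hOA⟩
    -- the touched relay of least rank
    obtain ⟨a₀, ha₀, ha₀min⟩ := Finset.exists_min_image (A.filter fun a => ∃ o ∈ O, (openGraph ω).Reachable o a) r
      (by obtain ⟨o, ho, a, ha, hoa⟩ := hOA; exact ⟨a, Finset.mem_filter.2 ⟨ha, o, ho, hoa⟩⟩)
    obtain ⟨ha₀A, hta₀⟩ := Finset.mem_filter.1 ha₀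
    have ha₀d : a₀ ≠ d := by rintro rfl; obtain ⟨o, ho, hod⟩ := hta₀; exact hOd o ho hod
    refine mem_iUnion₂.2 ⟨a₀, Finset.mem_erase.2 ⟨ha₀d, ha₀A⟩, ⟨hta₀, fun a' ha' hlt o ho hoa' => ?_⟩, hdb⟩
    have := ha₀min a' (Finset.mem_filter.2 ⟨ha', o, ho, hoa'⟩)
    omega
  have hlow : μ.real (openConn d b ∩ {ω : BondConfig (Fin n) | ∀ o ∈ O, ¬ (openGraph ω).Reachable o d} ∩
      {ω | ∃ o ∈ O, ∃ a ∈ A, (openGraph ω).Reachable o a}) ≤ ∑ a ∈ A.erase d, μ.real (P a ∩ openConn d b) :=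
    (measureReal_mono hcover (measure_ne_top μ _)).trans (measureReal_biUnion_finset_le _ _)
  -- upper bound: the events `P a ∩ {a ↔ b}`, `a ≠ d`, are disjoint subsets of `{O ~ b} ∩ {O ≁ d}`
  have hdisj : (↑(A.erase d) : Set (Fin n)).PairwiseDisjoint fun a => P a ∩ openConn a b := by
    intro a ha a' ha' hne
    rw [Function.onFun, Set.disjoint_left]
    rintro ω ⟨⟨hta, hexa⟩, _⟩ ⟨⟨hta', hexa'⟩, _⟩
    have haA : a ∈ A := Finset.mem_of_mem_erase (Finset.mem_coe.1 ha)
    have ha'A : a' ∈ A := Finset.mem_of_mem_erase (Finset.mem_coe.1 ha')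
    have hrne : r a ≠ r a' := fun h => hne (hrinj (Finset.mem_coe.2 haA) (Finset.mem_coe.2 ha'A) h)
    rcases lt_or_gt_of_ne hrne with hlt | hlt
    · obtain ⟨o, ho, hoa⟩ := hta; exact hexa' a haA hlt o ho hoa
    · obtain ⟨o, ho, hoa'⟩ := hta'; exact hexa a' ha'A hlt o ho hoa'
  have hsub : (⋃ a ∈ A.erase d, (P a ∩ openConn a b)) ⊆ ({ω : BondConfig (Fin n) | ∃ o ∈ O, (openGraph ω).Reachable o b} ∩
        {ω | ∀ o ∈ O, ¬ (openGraph ω).Reachable o d}) := by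
    intro ω hω
    obtain ⟨a, ha, ⟨hta, hexa⟩, hab⟩ := mem_iUnion₂.1 hω
    have had : a ≠ d := (Finset.mem_erase.1 ha).1
    have haA : a ∈ A := (Finset.mem_erase.1 ha).2
    obtain ⟨o, ho, hoa⟩ := hta
    exact ⟨⟨o, ho, hoa.trans hab⟩, fun o' ho' ho'd => hexa d hdA (hrd a haA had) o' ho' ho'd⟩
  have hup : ∑ a ∈ A.erase d, μ.real (P a ∩ openConn a b) ≤ μ.real ({ω : BondConfig (Fin n) | ∃ o ∈ O, (openGraph ω).Reachable o b} ∩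
        {ω | ∀ o ∈ O, ¬ (openGraph ω).Reachable o d}) := by
    rw [← measureReal_biUnion_finset hdisj (fun a _ => hmeas _)]
    exact measureReal_mono hsub (measure_ne_top μ _)
  exact hlow.trans (hpos'.trans hup)


/-- **Conjecture G (`stub_fingerML3_vp`, the finger multi-edge Lemma 3 in V⁺ form) from the set two-observer margin.**
The registered stub's conclusion for a block `N` with contacts in `A ∋ b` and a designated relay `d ∈ A` of least `μ_K(· ↔ b)`,
PROVIDED the set two-observer margin holds in the unglued weighting `K` for the observer set `N`, the functional `1{b ∈ ·}` and
the designated relay `d` (hypothesis `h2obs`, = the set-observer analogue of `PreFKGSurplus.preMargin_nonneg_of_csh` at `D = []`).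
Chain: `h2obs` ⟹ set pre-FKG surplus `≥ 0` (`setPreSurplus_nonneg_of_twoObs`) ⟹ SET-W (`setW_of_twoObs`) ⟹ the unglued set
form ⟹ the stub (`fingerML3_of_setForm`). [cite: KozmaNitzan2024, Thm 4 (pp. 12–14), display (3) (p. 3), Conj. 4 (p. 32)] -/
theorem fingerML3_of_twoObs (K : Sym2 (Fin n) → unitInterval) (A N : Finset (Fin n)) (d b : Fin n) (hbA : b ∈ A)
    (hNA : Disjoint N A) (hdA : d ∈ A) (hfree : ∀ v ∈ N, ∀ y : Fin n, y ∉ A → y ∉ N → (K s(v, y) : ℝ) = 0)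
    (hmin : ∀ a ∈ A, (prodBernoulli K).real (openConn d b) ≤ (prodBernoulli K).real (openConn a b))
    (h2obs : ∀ (r : Fin n → ℕ) (X' : Finset (Fin n)) (k : Fin n), d ∈ X' → k ∉ X' →
      (∀ a ∈ X', ∫ ω, (fun S : Set (Fin n) => if b ∈ S then (1 : ℝ) else 0) (openCluster ω d) ∂(prodBernoulli K) ≤
        ∫ ω, (fun S : Set (Fin n) => if b ∈ S then (1 : ℝ) else 0) (openCluster ω a) ∂(prodBernoulli K)) →
      (∀ a ∈ X', a ≠ d → r d < r a) → Set.InjOn r ↑X' →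
      (prodBernoulli K).real ({ω : BondConfig (Fin n) | ∃ o ∈ N, (openGraph ω).Reachable o k} ∩
          {ω | ∀ o ∈ N, ∀ a ∈ X', ¬ (openGraph ω).Reachable o a}) *
        (∫ ω in ⋃ a ∈ X', openConn k a, ((fun S : Set (Fin n) => if b ∈ S then (1 : ℝ) else 0) (openCluster ω k) -
          (fun S : Set (Fin n) => if b ∈ S then (1 : ℝ) else 0) (openCluster ω d)) ∂(prodBernoulli K)) ≤
      (prodBernoulli K).real {ω : BondConfig (Fin n) | ∀ a ∈ (↑X' : Set (Fin n)), ¬ (openGraph ω).Reachable k a} *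
        ∑ a ∈ X', ∫ ω in {ω : BondConfig (Fin n) | ∃ o ∈ N, (openGraph ω).Reachable o a} ∩
          {ω | ∀ a' ∈ X', r a' < r a → ∀ o ∈ N, ¬ (openGraph ω).Reachable o a'},
          ((fun S : Set (Fin n) => if b ∈ S then (1 : ℝ) else 0) (openCluster ω a) -
            (fun S : Set (Fin n) => if b ∈ S then (1 : ℝ) else 0) (openCluster ω d)) ∂(prodBernoulli K)) :
    (prodBernoulli (fun e' : Sym2 (Fin n) => if (∀ y ∈ e', y ∈ N) ∧ ¬ e'.IsDiag then 1 else K e')).real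
        ({ω : Set (Sym2 (Fin n)) | ∃ v ∈ N, ∃ a ∈ A, s(v, a) ∈ ω} ∩ openConn d b) ≤
      (prodBernoulli (fun e' : Sym2 (Fin n) => if (∀ y ∈ e', y ∈ N) ∧ ¬ e'.IsDiag then 1 else K e')).real
        ({ω : Set (Sym2 (Fin n)) | ∃ v ∈ N, ∃ a ∈ A, s(v, a) ∈ ω} ∩ ⋃ v ∈ N, openConn v b) := by
  set μ := prodBernoulli K with hμ
  refine fingerML3_of_setForm K A N d b hNA ?_
  have hW := setW_of_twoObs K A N d b hdA hmin h2obs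
  set R : Set (BondConfig (Fin n)) := {ω : Set (Sym2 (Fin n)) | ∃ v ∈ N, ∃ a ∈ A, s(v, a) ∈ ω} with hR
  set M : Set (BondConfig (Fin n)) := {ω : BondConfig (Fin n) | ∀ x ∈ (↑N : Set (Fin n)), ¬ (openGraph ω).Reachable d x} with hM
  -- the left-hand side of the set form sits inside the left-hand side of SET-W
  have h1 : (R ∩ M ∩ openConn d b) ⊆ (openConn d b ∩ {ω : BondConfig (Fin n) | ∀ o ∈ N, ¬ (openGraph ω).Reachable o d} ∩
      {ω | ∃ o ∈ N, ∃ a ∈ A, (openGraph ω).Reachable o a}) := by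
    rintro ω ⟨⟨⟨v, hv, a, ha, hva⟩, hMω⟩, hdb⟩
    have hvne : v ≠ a := fun h => Finset.disjoint_left.1 hNA hv (h ▸ ha)
    exact ⟨⟨hdb, fun o ho hod => hMω o (Finset.mem_coe.2 ho) hod.symm⟩,
      ⟨v, hv, a, ha, SimpleGraph.Adj.reachable ((openGraph_adj ω v a).2 ⟨hva, hvne⟩)⟩⟩
  -- the right-hand side of SET-W sits inside the right-hand side of the set form, up to the null event "N ↔ b off R"
  have h2 : ({ω : BondConfig (Fin n) | ∃ o ∈ N, (openGraph ω).Reachable o b} ∩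
      {ω | ∀ o ∈ N, ¬ (openGraph ω).Reachable o d}) ⊆
      (R ∩ M ∩ ⋃ v ∈ N, openConn v b) ∪ (Rᶜ ∩ ⋃ v ∈ N, ⋃ a ∈ A, openConn v a) := by
    rintro ω ⟨⟨o, ho, hob⟩, hNd⟩
    by_cases hRω : ω ∈ R
    · left
      refine ⟨⟨hRω, fun x hx hdx => hNd x (Finset.mem_coe.1 hx) hdx.symm⟩, mem_iUnion₂.2 ⟨o, ho, hob⟩⟩
    · right
      exact ⟨hRω, mem_iUnion₂.2 ⟨o, ho, mem_iUnion₂.2 ⟨b, hbA, hob⟩⟩⟩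
  have hnull : μ.real (Rᶜ ∩ ⋃ v ∈ N, ⋃ a ∈ A, openConn v a) = 0 := finger_noContact_reach_null K A N hNA hfree
  calc μ.real (R ∩ M ∩ openConn d b)
      ≤ μ.real (openConn d b ∩ {ω : BondConfig (Fin n) | ∀ o ∈ N, ¬ (openGraph ω).Reachable o d} ∩
          {ω | ∃ o ∈ N, ∃ a ∈ A, (openGraph ω).Reachable o a}) := measureReal_mono h1 (measure_ne_top μ _)
    _ ≤ μ.real ({ω : BondConfig (Fin n) | ∃ o ∈ N, (openGraph ω).Reachable o b} ∩
          {ω | ∀ o ∈ N, ¬ (openGraph ω).Reachable o d}) := hW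
    _ ≤ μ.real ((R ∩ M ∩ ⋃ v ∈ N, openConn v b) ∪ (Rᶜ ∩ ⋃ v ∈ N, ⋃ a ∈ A, openConn v a)) :=
          measureReal_mono h2 (measure_ne_top μ _)
    _ ≤ μ.real (R ∩ M ∩ ⋃ v ∈ N, openConn v b) + μ.real (Rᶜ ∩ ⋃ v ∈ N, ⋃ a ∈ A, openConn v a) :=
          measureReal_union_le _ _
    _ = μ.real (R ∩ M ∩ ⋃ v ∈ N, openConn v b) := by rw [hnull, add_zero]

end SetSurplus

end Summit.CriticalPhenomena.PercolationContinuityZ3.Theorems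

end
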